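import Summits.CriticalPhenomena.PercolationContinuityZ3.Theorems.Transplant.SkelFrmBParamsFaceCountsYA
import Summits.CriticalPhenomena.PercolationContinuityZ3.Theorems.Transplant.SkelFrmBParamsFaceFloorsZYA
import Summits.CriticalPhenomena.PercolationContinuityZ3.Theorems.Transplant.PlanarSkeletonFrmDefs
import Summits.CriticalPhenomena.PercolationContinuityZ3.Theorems.Transplant.SkelPhiStepIDataNS
import Summits.CriticalPhenomena.PercolationContinuityZ3.Theorems.Transplant.SkelNegBParamsFaceCountsRangeYA
import HarnessLib
/-!
(F) VALUE LAYER, N2 twin (hp-8 g42, 2026-08-23; F-DISCHARGE-MAP-N2 G18 y′-face counts in range, (Δ1)/(R-22)): N1 `SkelNegBParamsFaceCountsRangeYA` (hp-8 g36) over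
the generic staggered cells `(P : PCells2T) (hP : P.toPCells2 = fcellsA …)` and `…FaceCountsYA`/`…FaceFloorsZYA` (N2): `along_target_bounds₁`, `NrY_range` (600·Kq),
**`N3Y_range` creep-aware: `N3Y + 1 ≤ 240·Kq + 10`** (tangential target = staggered neighbour centre, `c 1 ≤ r 0`; takes `du`), `clr_NrY_lb`.
NON-VACUITY: arithmetic under `EqNumL`, the provider's level/offset hypotheses and the reading bounds.
builds on p205010 (kernel theorem, internal audit signed; external expert review pending); nothing here is a claim about the open node `SamePDropOfSkeletonFrm₁`.
N1 HEADER (kept for the reader):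
# N1 params, M3′ part 1a — **THE y′-FACE RUN COUNTS ARE IN RANGE** (the twin of p3-g12's `SkelNegBParamsFaceCountsRangeA` over hp-8 g36's y′-face
# counts `KS.T1Y/T0Y/NrY/σTY/N3Y`, `SkelNegBParamsFaceCountsYA`): the along target of the y′-run is at least one region ahead of the landing origin and at
# most `15r₁ + E + C` away, so `NrY + 1 ≤ 600·Kq` and `200·Kq ≤ NrY + 8`; the x-run's transverse target is within the band `kE + C₀ + 2u₀`, so
# `N3Y + 1 ≤ 200·Kq + 10`; p3's `counts_budget` then gives the glue's cap `NrY + N3Y + 2 ≤ nFA κ.K₀` and the `+ 1 ≤ 1000·Kq` ranges my G-π′ lemmas read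
(p1-g14, 2026-08-22; CLAIM M3 y′/G-R′, lane INBOX 09:13:30Z).  The origin-reading constants `C` (`|F1cA yL| ≤ C`) and `C₀` (`|FcA yL| ≤ C₀`) are hypotheses,
discharged per landing origin by G-O′; `E ≤ u₁` is the face-apron reach room; `kE ≤ 5r₀` the band.
builds on p205010 (kernel theorem, internal audit signed; external expert review pending) — nothing in this file uses p205010; NOTHING is claimed about the node
`SamePDropOfSkeletonNeg₁` (OPEN); arithmetic only.
Lane `prim-bschramm-*`, seat `prim-bschramm-p1` (gen 14); helper file (`--supports stmt-CriticalPhenomena-4575 --as helper`).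
* `along_target_bounds₁` (⇐ hp-8's `faceL_bounds₁`, FloorsZYA p324287), **`NrY_range`**, **`N3Y_range`**, **`clr_NrY_lb`**, `capY_of_ranges`.
[cite: KozmaNitzan2024, §4 Lemma 11 (p. 22), Lemma 12 (pp. 23–25)] [cite: MartineauTassion2017, §4.1]
-/

noncomputable section

open scoped Classical

namespace Summit.CriticalPhenomena.PercolationContinuityZ3.Theorems.Transplant

namespace PlanarSkeletonFrm

namespace NegB

open Literature.Probability.Percolation Literature.Probability.LatticeModels SimpleGraph
open Literature.Probability.Percolation.KozmaNitzan.Cells (oth sgOf sgOf_sign)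
open SkelConc (Consts)
open Skelφ.StepI (DataN)
open Neg

namespace KS

section RangesY

/-- **The along target of the y′-run is ahead of the landing origin and bounded**: `5r₁ + 1 − E − C ≤ σ·(T1Y − F1cA yL) ≤ 15r₁ − 10u₁ + 1 + E + C`.
[folklore] -/
theorem along_target_bounds₁ (κ : Consts) {V : Type} [DecidableEq V] [Countable V] {G : SimpleGraph V} [G.LocallyFinite] (Φ : PlanarSkeletonFrm G) (t : V) (p : unitInterval) (D : Skelφ.StepI.DataNS V) (g : ℕ) (f : ℕ) (P : PCells2T) (hP : P.toPCells2 = fcellsA κ Φ t p D g f) (x : Site 2) (du : MDir) (hd : du.1 = 1) (z : Site 2) {j E : ℕ} (hj : j < P.K)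
    (hlev1 : P.faceL 1 j - E ≤ P.lev du x z)
    (hlev2 : P.lev du x z ≤ P.faceL 1 j + E)
    (yL : Site 2) {C : ℤ} (he : |F1cA κ Φ t p D g f yL| ≤ C) :
    5 * (P.r 1 : ℤ) + 1 - E - C ≤ sgOf du * (T1Y P x du z - F1cA κ Φ t p D g f yL) ∧
      sgOf du * (T1Y P x du z - F1cA κ Φ t p D g f yL) ≤ 15 * (P.r 1 : ℤ) - 10 * u₁A κ Φ t p D g f + 1 + E + C := by
  have hT := T1Y_eq P x du hd z
  obtain ⟨f1, f2⟩ := faceL_bounds₁ κ Φ t p D g f P hP j hj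
  have hσ : sgOf du = 1 ∨ sgOf du = -1 := sgOf_sign du
  obtain ⟨e1, e2⟩ := abs_le.1 he
  set F := F1cA κ Φ t p D g f yL
  have hσF : |sgOf du * F| ≤ C := by rcases hσ with h | h <;> simp [h, abs_le] <;> constructor <;> linarith
  obtain ⟨s1, s2⟩ := abs_le.1 hσF
  rw [mul_sub, hT]
  constructor <;> linarith

/-- **THE ALONG COUNT OF THE y′-RUN IS IN RANGE**: the target is at least one region ahead (the precondition of `NrY_spec`) and `NrY + 1 ≤ 600·Kq`,
whenever `E + C ≤ 8·u₁`. [cite: KozmaNitzan2024, §4 Lemma 11 (p. 22)] -/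
theorem NrY_range (κ : Consts) {V : Type} [DecidableEq V] [Countable V] {G : SimpleGraph V} [G.LocallyFinite] (Φ : PlanarSkeletonFrm G) (t : V) (p : unitInterval) (D : Skelφ.StepI.DataNS V) (g : ℕ) (f : ℕ) (P : PCells2T) (hP : P.toPCells2 = fcellsA κ Φ t p D g f) (x : Site 2) (du : MDir) (hd : du.1 = 1) (z : Site 2) {j E : ℕ} (hj : j < P.K)
    (hlev1 : P.faceL 1 j - E ≤ P.lev du x z)
    (hlev2 : P.lev du x z ≤ P.faceL 1 j + E)
    (yL : Site 2) {C : ℤ} (he : |F1cA κ Φ t p D g f yL| ≤ C) (hEC : (E : ℤ) + C ≤ 8 * u₁A κ Φ t p D g f) :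
    u₁A κ Φ t p D g f ≤ sgOf du * (T1Y P x du z - F1cA κ Φ t p D g f yL) ∧
      NrY κ Φ t p D g f P yL x du z + 1 ≤ 600 * Neg.Kq κ := by
  obtain ⟨a1, a2⟩ := along_target_bounds₁ κ Φ t p D g f P hP x du hd z hj hlev1 hlev2 yL he
  have hu : 1 ≤ u₁A κ Φ t p D g f := (units_eqA κ Φ t p D g f).2.2.2.2.2
  have hr : (P.r 1 : ℤ) = 40 * (Neg.Kq κ : ℤ) * u₁A κ Φ t p D g f := by rw [(cells_of_hP κ Φ t p D g f P hP).1 1]; exact (units_eqA κ Φ t p D g f).2.2.2.1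
  have hq : (1 : ℤ) ≤ Neg.Kq κ := by exact_mod_cast Neg.one_le_Kq κ
  have hC0 : 0 ≤ C := le_trans (abs_nonneg _) he
  set u := u₁A κ Φ t p D g f
  set Q := (Neg.Kq κ : ℤ)
  have hQu : u ≤ Q * u := by nlinarith
  have hX : u ≤ sgOf du * (T1Y P x du z - F1cA κ Φ t p D g f yL) := by nlinarith
  refine ⟨hX, ?_⟩
  obtain ⟨-, r2⟩ := NrY_spec κ Φ t p D g f P yL x du z hX
  have h1 : u * ((NrY κ Φ t p D g f P yL x du z : ℤ) + 1) ≤ u * (600 * Q) := by nlinarith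
  have h2 : ((NrY κ Φ t p D g f P yL x du z : ℤ) + 1) ≤ 600 * Q := le_of_mul_le_mul_left h1 (by linarith)
  have h3 : ((NrY κ Φ t p D g f P yL x du z + 1 : ℕ) : ℤ) ≤ ((600 * Neg.Kq κ : ℕ) : ℤ) := by push_cast; exact h2
  exact_mod_cast h3

/-- **THE TANGENTIAL COUNT OF THE x-RUN IS IN RANGE**: `N3Y + 1 ≤ 200·Kq + 10` whenever the contact's transverse offset is within the band
`kE ≤ 5r₀` and the landing origin's abscissa reading within eight strides. [folklore] -/
theorem N3Y_range (κ : Consts) {V : Type} [DecidableEq V] [Countable V] {G : SimpleGraph V} [G.LocallyFinite] (Φ : PlanarSkeletonFrm G) (t : V) (p : unitInterval) (D : Skelφ.StepI.DataNS V) (g : ℕ) (f : ℕ) (P : PCells2T) (hP : P.toPCells2 = fcellsA κ Φ t p D g f) (yL x : Site 2) (du : MDir) (hd : du.1 = 1) (z : Site 2) {kE C₀ : ℤ} (hz : |z 0 - P.cenS x 0| ≤ kE)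
    (hkE : kE ≤ 5 * (P.r 0 : ℤ)) (hC0 : |FcA κ Φ t p D g f yL| ≤ C₀) (hC0' : C₀ ≤ 8 * u₀A κ Φ t p D g f) :
    N3Y κ Φ t p D g f P yL x du z + 1 ≤ 240 * Neg.Kq κ + 10 := by
  obtain ⟨-, r2, -⟩ := N3Y_spec κ Φ t p D g f P yL x du z
  have hu : 1 ≤ u₀A κ Φ t p D g f := (units_eqA κ Φ t p D g f).2.2.2.2.1
  have hr : (P.r 0 : ℤ) = 40 * (Neg.Kq κ : ℤ) * u₀A κ Φ t p D g f := by rw [(cells_of_hP κ Φ t p D g f P hP).1 0]; exact (units_eqA κ Φ t p D g f).2.2.1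
  set u := u₀A κ Φ t p D g f
  set Q := (Neg.Kq κ : ℤ)
  have hc0 : 0 ≤ P.c 1 := P.hc0 1
  have hc1 : P.c 1 ≤ (P.r 0 : ℤ) := by have h := P.hcr 1; rwa [show oth (1 : Fin 2) = 0 from rfl] at h
  have hstep := cenS_step_zero P x du hd
  have hσ : |sgOf du * P.c 1| ≤ (P.r 0 : ℤ) := by
    rcases sgOf_sign du with h | h <;> rw [h] <;> simp [abs_le] <;> constructor <;> linarith
  have hT : |T0Y P x du z - FcA κ Φ t p D g f yL| ≤ kE + (P.r 0 : ℤ) + C₀ := by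
    unfold T0Y
    rw [hstep]
    calc |P.cenS x 0 + sgOf du * P.c 1 - z 0 - FcA κ Φ t p D g f yL|
        = |-(z 0 - P.cenS x 0) + sgOf du * P.c 1 + -FcA κ Φ t p D g f yL| := by ring_nf
      _ ≤ |-(z 0 - P.cenS x 0) + sgOf du * P.c 1| + |-FcA κ Φ t p D g f yL| := abs_add_le _ _
      _ ≤ |-(z 0 - P.cenS x 0)| + |sgOf du * P.c 1| + |-FcA κ Φ t p D g f yL| := by linarith [abs_add_le (-(z 0 - P.cenS x 0)) (sgOf du * P.c 1)]
      _ ≤ kE + (P.r 0 : ℤ) + C₀ := by rw [abs_neg, abs_neg]; linarith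
  have h1 : u * ((N3Y κ Φ t p D g f P yL x du z : ℤ) + 1) ≤ u * (240 * Q + 10) := by nlinarith
  have h2 : ((N3Y κ Φ t p D g f P yL x du z : ℤ) + 1) ≤ 240 * Q + 10 := le_of_mul_le_mul_left h1 (by linarith)
  have h3 : ((N3Y κ Φ t p D g f P yL x du z + 1 : ℕ) : ℤ) ≤ ((240 * Neg.Kq κ + 10 : ℕ) : ℤ) := by push_cast; exact h2
  exact_mod_cast h3

/-- **THE ALONG COUNT OF THE y′-RUN IS AT LEAST `200·Kq − 8`** (`5r₁ = 200·Kq·u₁` ahead, the origin within `E + C ≤ 7u₁`, the run ends within one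
region of the target). [folklore] -/
theorem clr_NrY_lb (κ : Consts) {V : Type} [DecidableEq V] [Countable V] {G : SimpleGraph V} [G.LocallyFinite] (Φ : PlanarSkeletonFrm G) (t : V) (p : unitInterval) (D : Skelφ.StepI.DataNS V) (g : ℕ) (f : ℕ) (P : PCells2T) (hP : P.toPCells2 = fcellsA κ Φ t p D g f) (x : Site 2) (du : MDir) (hd : du.1 = 1) (z : Site 2) {j E : ℕ} (hj : j < P.K)
    (hlev1 : P.faceL 1 j - E ≤ P.lev du x z)
    (hlev2 : P.lev du x z ≤ P.faceL 1 j + E)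
    (yL : Site 2) {C : ℤ} (he : |F1cA κ Φ t p D g f yL| ≤ C) (hEC : (E : ℤ) + C ≤ 7 * u₁A κ Φ t p D g f) :
    200 * (Neg.Kq κ : ℤ) ≤ (NrY κ Φ t p D g f P yL x du z : ℤ) + 8 := by
  obtain ⟨a1, -⟩ := along_target_bounds₁ κ Φ t p D g f P hP x du hd z hj hlev1 hlev2 yL he
  have hu : 1 ≤ u₁A κ Φ t p D g f := (units_eqA κ Φ t p D g f).2.2.2.2.2
  obtain ⟨hX, -⟩ := NrY_range κ Φ t p D g f P hP x du hd z hj hlev1 hlev2 yL he (by linarith)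
  obtain ⟨hf, -⟩ := NrY_spec κ Φ t p D g f P yL x du z hX
  have hr : (P.r 1 : ℤ) = 40 * (Neg.Kq κ : ℤ) * u₁A κ Φ t p D g f := by rw [(cells_of_hP κ Φ t p D g f P hP).1 1]; exact (units_eqA κ Φ t p D g f).2.2.2.1
  have hσ : sgOf du = 1 ∨ sgOf du = -1 := sgOf_sign du
  set u := u₁A κ Φ t p D g f
  set Q : ℤ := (Neg.Kq κ : ℤ)
  set N : ℤ := (NrY κ Φ t p D g f P yL x du z : ℤ)
  set T := T1Y P x du z
  set F := F1cA κ Φ t p D g f yL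
  obtain ⟨hf1, hf2⟩ := abs_le.1 hf
  have key : (200 * Q - 8) * u + 1 ≤ u * (N + 1) := by
    rcases hσ with h | h <;> rw [h] at hf1 hf2 a1 <;> nlinarith
  by_contra hc
  push Not at hc
  have h1 : N + 9 - 200 * Q ≤ 0 := by linarith
  have h2 : u * (N + 9 - 200 * Q) ≤ 0 := mul_nonpos_of_nonneg_of_nonpos (by linarith) h1
  nlinarith

export PlanarSkeletonNeg.NegB.KS (capY_of_ranges)

end RangesY

end KS

end NegB

end PlanarSkeletonFrm

end Summit.CriticalPhenomena.PercolationContinuityZ3.Theorems.Transplant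

end
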